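import Literature.MathematicalPhysics.QuantumLattice.HubbardOpenBoxCodedClusterCertificateBlocks
import Literature.MathematicalPhysics.QuantumLattice.HubbardOpenBoxWeightedCodedHamiltonian
import HarnessLib

/-!
# The coded cluster oracle of the WEIGHTED open `t–t'–U` cluster (kernel ED floors of weighted Anderson clusters)

Topic `MathematicalPhysics/QuantumLattice`, family `hubbard`. The instance of the generic data-free floor chain
(`HubbardOpenBoxCodedClusterRows` / `…Certificate` / `…CertificateBlocks`) for the weighted cluster
`hubbardOpenBoxTT'W a b τ υ ν` of the Valentí–Stolze–Hirschfeld weighted Anderson cover (1991 §II;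
`HubbardNNNHoppingWeightedOpenBox`, cover law `ClusterLowerBound.energyDensityTT'_ge_of_boxFloorsW_2x3`) with
RATIONAL weight tables on the row-major site ranks, `τ x y = W (rk x) (rk y)/Q`, `υ x = V (rk x)/Q`,
`ν x = M (rk x)/Q`; entry dictionary `hubbardOpenBoxTT'W_apply_eq_hzIntW_div` (`HubbardOpenBoxWeightedCodedHamiltonian`).

* §1 the coded APPLICATION of `Q·h^W` to a coded vector (Lin–Gubernatis 1993 §II): weighted orbital-pair
  lists `hopOrbsW`, `hopListSumW` (`= openBoxHopApplyW`, `hopListSumW_hopOrbsW`), the weighted double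
  occupancy / density of a code `doccOfW`, `densOfW`, and **`hubbardOpenBoxTT'W_mulVec_code`**:
  `(h^W(W,V,M) φ_f)(s) = −hopListSumW + (doccOfW + densOfW)·f` at `code s`;
* §2 the a-priori bound `hzBoundW` (`abs_hzIntW_le`), the spin-exchange invariance
  `relabel_spinSwap_hubbardOpenBoxTT'W`, the ORACLE **`weightedCluster a b W V M : CodedCluster`** and its
  semantics **`weightedCluster_models`** (`Models … (hzIntW a b W V M) Q (h^W(W/Q, V/Q, M/Q))` for symmetric `W`),
  the symmetrised table `symW` (so that symmetry needs no hypothesis), and the certificate form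
  **`groundEnergy_ge_of_kCertsW₃`**: kernel-checked sector certificates (`KCert.PassesG`, sectors `p ≤ q`)
  ⇒ `σ ≤ E₀(h^W_{a×b}(W/Q, V/Q, M/Q), k)` — the hypothesis `hF` of `energyDensityTT'_ge_of_boxFloorsW_2x3`.

Everything is proved; no named fact; nothing numerical is asserted here.

## References

* H. Q. Lin, J. E. Gubernatis, Comput. Phys. 7 (1993) 400, §II. [cite: LinGubernatis1993, §II]
* R. Valentí, J. Stolze, P. J. Hirschfeld, Phys. Rev. B 43 (1991) 13743, §II. [cite: ValentiStolzeHirschfeld1991, §II]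
* I. Kull, N. Schuch, B. Dive, M. Navascués, PRX 14 (2024) 021008, §5.3. [cite: KullEtAl2024, §5.3]
* E. H. Lieb, PRL 62 (1989) 1201, proof of Thm 1 (spin exchange). [cite: LiebPRL1989, proof of Theorem 1]
-/

noncomputable section

namespace Literature.MathematicalPhysics.QuantumLattice

namespace OccupationCode

open Finset Matrix ClusterLowerBound Literature.Computation.Certificates

/-! ### §1 Coded application of the weighted cluster Hamiltonian -/

/-- The weighted ordered orbital pairs `(2P + σ, 2Q + σ, W P Q)` over the adjacent site pairs of a coded adjacency
(computed once per certificate). [cite: LinGubernatis1993, §II] -/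
def hopOrbsW (W : ℕ → ℕ → ℤ) (adj : ℕ → ℕ → Bool) (N : ℕ) : List (ℕ × ℕ × ℤ) :=
  (List.range N).flatMap fun P => (List.range N).flatMap fun Q =>
    if adj P Q then [(2 * P, 2 * Q, W P Q), (2 * P + 1, 2 * Q + 1, W P Q)] else []

/-- `Σ_{(p,q,w) ∈ l} w · hopApplyPar p q m f` (structural). [cite: LinGubernatis1993, §II] -/
def hopListSumW (m : ℕ) (f : ℕ → ℤ) : List (ℕ × ℕ × ℤ) → ℤ
  | [] => 0
  | pqw :: rest => pqw.2.2 * hopApplyPar pqw.1 pqw.2.1 m f + hopListSumW m f rest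

/-- Weighted coded application of the hopping matrix: `Σ_{P ~ Q} W P Q · Σ_σ hopApply (2P+σ) (2Q+σ)`.
[cite: LinGubernatis1993, §II] -/
def openBoxHopApplyW (W : ℕ → ℕ → ℤ) (adj : ℕ → ℕ → Bool) (N m : ℕ) (f : ℕ → ℤ) : ℤ :=
  sumNat (fun P => sumNat (fun Q => if adj P Q then
    W P Q * sumNat (fun σ => hopApply (2 * P + σ) (2 * Q + σ) m f) 2 else 0) N) N

/-- `hopListSumW` is the list sum. [folklore] -/
private theorem hopListSumW_eq_sum (m : ℕ) (f : ℕ → ℤ) :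
    ∀ l : List (ℕ × ℕ × ℤ), hopListSumW m f l = (l.map fun pqw => pqw.2.2 * hopApplyPar pqw.1 pqw.2.1 m f).sum
  | [] => rfl
  | pqw :: rest => by rw [hopListSumW, hopListSumW_eq_sum m f rest, List.map_cons, List.sum_cons]

/-- Sum over a `flatMap`. [folklore] -/
private theorem sum_map_flatMap' {α β : Type*} (l : List α) (g : α → List β) (F : β → ℤ) :
    ((l.flatMap g).map F).sum = (l.map fun a => ((g a).map F).sum).sum := by
  induction l with
  | nil => rfl
  | cons a l ih => rw [List.flatMap_cons, List.map_append, List.sum_append, ih, List.map_cons, List.sum_cons]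

/-- A list sum over `List.range N` is the `Finset.range` sum. [folklore] -/
private theorem sum_map_range' (g : ℕ → ℤ) : ∀ N : ℕ, ((List.range N).map g).sum = ∑ P ∈ range N, g P
  | 0 => rfl
  | N + 1 => by
      rw [List.range_succ, List.map_append, List.sum_append, sum_map_range' g N, Finset.sum_range_succ]
      simp

/-- **The weighted adjacency-list hop sum is the weighted coded hop application**:
`hopListSumW m f (hopOrbsW W adj N) = openBoxHopApplyW W adj N m f`. [cite: LinGubernatis1993, §II] -/
theorem hopListSumW_hopOrbsW (W : ℕ → ℕ → ℤ) (adj : ℕ → ℕ → Bool) (N m : ℕ) (f : ℕ → ℤ) :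
    hopListSumW m f (hopOrbsW W adj N) = openBoxHopApplyW W adj N m f := by
  rw [openBoxHopApplyW, sumNat_eq, hopListSumW_eq_sum, hopOrbsW, sum_map_flatMap', sum_map_range']
  refine Finset.sum_congr rfl fun P _ => ?_
  rw [sumNat_eq, sum_map_flatMap', sum_map_range']
  refine Finset.sum_congr rfl fun Q _ => ?_
  split_ifs with h
  · simp [sumNat, hopApplyPar_eq]; ring
  · simp

/-- **Weighted double occupancy of a code**: `Σ_P V P · [bits 2P, 2P+1 of m set]`. [cite: LinGubernatis1993, §II] -/
def doccOfW (V : ℕ → ℤ) (N m : ℕ) : ℤ :=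
  sumNat (fun P => if m.testBit (2 * P) && m.testBit (2 * P + 1) then V P else 0) N

/-- **Weighted particle number of a code**: `Σ_P M P · ([bit 2P set] + [bit 2P+1 set])`. [cite: LinGubernatis1993, §II] -/
def densOfW (M : ℕ → ℤ) (N m : ℕ) : ℤ :=
  sumNat (fun P => (if m.testBit (2 * P) then M P else 0) + (if m.testBit (2 * P + 1) then M P else 0)) N

/-- The a-priori bound against digit overflow: `|hzIntW| ≤ 2·ΣΣ|W| + Σ|V| + 2·Σ|M|`. [cite: LinGubernatis1993, §II] -/
def hzBoundW (N : ℕ) (W : ℕ → ℕ → ℤ) (V M : ℕ → ℤ) : ℕ :=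
  2 * sumNat (fun P => sumNat (fun Q => (W P Q).natAbs) N) N + sumNat (fun P => (V P).natAbs) N +
    2 * sumNat (fun P => (M P).natAbs) N

/-- **THE ORACLE of the weighted cluster** `Q·h^W_{a×b}(W/Q, V/Q, M/Q)`: coded application
`−hopListSumW (nn ∨ diag pairs, weights W) + (doccOfW V + densOfW M)·f`, bound `hzBoundW`.
[cite: LinGubernatis1993, §II] [cite: ValentiStolzeHirschfeld1991, §II] -/
def weightedCluster (a b : ℕ) (W : ℕ → ℕ → ℤ) (V M : ℕ → ℤ) : CodedCluster where
  app m f := -hopListSumW m f (hopOrbsW W (boxAdjCode b) (a * b)) + (doccOfW V (a * b) m + densOfW M (a * b) m) * f m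
  bound := hzBoundW (a * b) W V M

section Box

variable {a b : ℕ}

/-- Applying a finite sum of matrices. [folklore] -/
private theorem sum_mulVec_apply' {ι κ : Type*} [Fintype κ] (S : Finset ι) (A : ι → Matrix κ κ ℂ) (v : κ → ℂ)
    (x : κ) : ((∑ i ∈ S, A i) *ᵥ v) x = ∑ i ∈ S, (A i *ᵥ v) x := by
  rw [Matrix.sum_mulVec, Finset.sum_apply]

/-- Casting a structural integer sum. [folklore] -/
private theorem cast_sumNat'' (f : ℕ → ℤ) : ∀ n : ℕ, ((sumNat f n : ℤ) : ℂ) = sumNat (fun i => (f i : ℂ)) n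
  | 0 => by simp [sumNat]
  | n + 1 => by rw [sumNat, sumNat, Int.cast_add, cast_sumNat'' f n]

/-- The weighted hopping part applied to a coded vector, in code form. [cite: LinGubernatis1993, §II] -/
theorem sum_hopW_mulVec_code (W : ℕ → ℕ → ℤ) (f : ℕ → ℤ) (s : Finset (Orb (Fin a ×ₗ Fin b))) :
    ((∑ x : Fin a ×ₗ Fin b, ∑ y : Fin a ×ₗ Fin b, ∑ σ : Fin 2,
        if (rectBoxGraph a b).Adj x y ∨ (rectBoxDiagGraph a b).Adj x y then
          (((W (siteRank x) (siteRank y) : ℤ) : ℝ) : ℂ) • (creation (orb x σ) * annihilation (orb y σ)) else 0) *ᵥ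
        codedVec f) s =
      ((openBoxHopApplyW W (boxAdjCode b) (a * b) (code s) f : ℤ) : ℂ) := by
  have hcast : ((openBoxHopApplyW W (boxAdjCode b) (a * b) (code s) f : ℤ) : ℂ) =
      sumNat (fun P => sumNat (fun Q => if boxAdjCode b P Q then
        ((W P Q : ℤ) : ℂ) * sumNat (fun σ => (hopApply (2 * P + σ) (2 * Q + σ) (code s) f : ℂ)) 2 else 0) (a * b))
        (a * b) := by
    simp only [openBoxHopApplyW, sumNat_eq]
    push_cast
    rfl
  rw [hcast, sum_mulVec_apply', ← sum_site_eq_sumNat]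
  refine Finset.sum_congr rfl fun x _ => ?_
  rw [sum_mulVec_apply', ← sum_site_eq_sumNat]
  refine Finset.sum_congr rfl fun y _ => ?_
  rw [sum_mulVec_apply']
  by_cases hxy : (rectBoxGraph a b).Adj x y ∨ (rectBoxDiagGraph a b).Adj x y
  · rw [if_pos ((boxAdjCode_siteRank x y).2 hxy), Fin.sum_univ_two, if_pos hxy, if_pos hxy, Matrix.smul_mulVec,
      Matrix.smul_mulVec, Pi.smul_apply, Pi.smul_apply, smul_eq_mul, smul_eq_mul, sumNat, sumNat, sumNat,
      creation_mul_annihilation_mulVec_code, creation_mul_annihilation_mulVec_code,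
      orbRank_orb, orbRank_orb, orbRank_orb, orbRank_orb]
    push_cast
    simp only [Fin.val_zero, Fin.val_one, add_zero, zero_add]
    ring
  · have : boxAdjCode b (siteRank x) (siteRank y) = false := Bool.eq_false_iff.2 fun h => hxy ((boxAdjCode_siteRank x y).1 h)
    rw [this]
    simp [hxy]

/-- The weighted double occupancy applied to a coded vector, in code form. [cite: LinGubernatis1993, §II] -/
theorem sum_doccW_mulVec_code (V : ℕ → ℤ) (f : ℕ → ℤ) (s : Finset (Orb (Fin a ×ₗ Fin b))) :
    ((∑ x : Fin a ×ₗ Fin b, (((V (siteRank x) : ℤ) : ℝ) : ℂ) • (numberOp x 0 * numberOp x 1)) *ᵥ codedVec f) s =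
      ((doccOfW V (a * b) (code s) * f (code s) : ℤ) : ℂ) := by
  rw [sum_mulVec_apply', doccOfW, Int.cast_mul, cast_sumNat'', ← sum_site_eq_sumNat, Finset.sum_mul]
  refine Finset.sum_congr rfl fun x _ => ?_
  rw [Matrix.smul_mulVec, Pi.smul_apply, smul_eq_mul, numberOp_mul_numberOp_eq_diagonal, mulVec_diagonal, codedVec]
  have h0 := mem_iff_testBit_code s (orb x 0)
  have h1 := mem_iff_testBit_code s (orb x 1)
  rw [orbRank_orb] at h0 h1
  simp only [Fin.val_zero, add_zero, Fin.val_one] at h0 h1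
  by_cases hx0 : orb x 0 ∈ s
  · by_cases hx1 : orb x 1 ∈ s
    · rw [if_pos ⟨hx0, hx1⟩, h0.1 hx0, h1.1 hx1]; push_cast; simp
    · have : (code s).testBit (2 * siteRank x + 1) = false := Bool.eq_false_iff.2 fun h => hx1 (h1.2 h)
      rw [if_neg (fun h => hx1 h.2), this]; push_cast; simp
  · have : (code s).testBit (2 * siteRank x) = false := Bool.eq_false_iff.2 fun h => hx0 (h0.2 h)
    rw [if_neg (fun h => hx0 h.1), this]; push_cast; simp

/-- The weighted density applied to a coded vector, in code form. [cite: LinGubernatis1993, §II] -/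
theorem sum_densW_mulVec_code (M : ℕ → ℤ) (f : ℕ → ℤ) (s : Finset (Orb (Fin a ×ₗ Fin b))) :
    ((∑ x : Fin a ×ₗ Fin b, (((M (siteRank x) : ℤ) : ℝ) : ℂ) • (numberOp x 0 + numberOp x 1)) *ᵥ codedVec f) s =
      ((densOfW M (a * b) (code s) * f (code s) : ℤ) : ℂ) := by
  rw [sum_mulVec_apply', densOfW, Int.cast_mul, cast_sumNat'', ← sum_site_eq_sumNat, Finset.sum_mul]
  refine Finset.sum_congr rfl fun x _ => ?_
  rw [Matrix.smul_mulVec, Pi.smul_apply, smul_eq_mul, LiebThm1.numberOp_eq_diagonal, LiebThm1.numberOp_eq_diagonal,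
    diagonal_add, mulVec_diagonal, codedVec]
  have h0 := mem_iff_testBit_code s (orb x 0)
  have h1 := mem_iff_testBit_code s (orb x 1)
  rw [orbRank_orb] at h0 h1
  simp only [Fin.val_zero, add_zero, Fin.val_one] at h0 h1
  by_cases hx0 : orb x 0 ∈ s
  · by_cases hx1 : orb x 1 ∈ s
    · rw [if_pos hx0, if_pos hx1, h0.1 hx0, h1.1 hx1]; push_cast; simp; ring
    · have : (code s).testBit (2 * siteRank x + 1) = false := Bool.eq_false_iff.2 fun h => hx1 (h1.2 h)
      rw [if_pos hx0, if_neg hx1, h0.1 hx0, this]; push_cast; simp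
  · have h0' : (code s).testBit (2 * siteRank x) = false := Bool.eq_false_iff.2 fun h => hx0 (h0.2 h)
    by_cases hx1 : orb x 1 ∈ s
    · rw [if_neg hx0, if_pos hx1, h0', h1.1 hx1]; push_cast; simp
    · have : (code s).testBit (2 * siteRank x + 1) = false := Bool.eq_false_iff.2 fun h => hx1 (h1.2 h)
      rw [if_neg hx0, if_neg hx1, h0', this]; push_cast; simp

/-- **The weighted cluster Hamiltonian on a coded vector** (integer weight tables), in code form:
`(h^W(W, V, M) φ_f)(s) = (weightedCluster a b W V M).app (code s) f`. [cite: LinGubernatis1993, §II] -/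
theorem hubbardOpenBoxTT'W_mulVec_code (W : ℕ → ℕ → ℤ) (V M : ℕ → ℤ) (f : ℕ → ℤ)
    (s : Finset (Orb (Fin a ×ₗ Fin b))) :
    (hubbardOpenBoxTT'W a b (fun x y => ((W (siteRank x) (siteRank y) : ℤ) : ℝ)) (fun x => ((V (siteRank x) : ℤ) : ℝ))
        (fun x => ((M (siteRank x) : ℤ) : ℝ)) *ᵥ codedVec f) s =
      (((weightedCluster a b W V M).app (code s) f : ℤ) : ℂ) := by
  rw [hubbardOpenBoxTT'W, add_mulVec, add_mulVec, neg_mulVec, Pi.add_apply, Pi.add_apply, Pi.neg_apply,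
    sum_hopW_mulVec_code, sum_doccW_mulVec_code, sum_densW_mulVec_code]
  show _ = (((-hopListSumW (code s) f (hopOrbsW W (boxAdjCode b) (a * b)) +
    (doccOfW V (a * b) (code s) + densOfW M (a * b) (code s)) * f (code s) : ℤ) : ℤ) : ℂ)
  rw [hopListSumW_hopOrbsW]
  push_cast
  ring

/-- **The weighted cluster Hamiltonian on a coded vector** (rational weights `W/Q, V/Q, M/Q`):
`(h^W φ_f)(s) = app (code s) f / Q`. [cite: LinGubernatis1993, §II] -/
theorem hubbardOpenBoxTT'W_mulVec_code_div (W : ℕ → ℕ → ℤ) (V M : ℕ → ℤ) (Q : ℕ) (f : ℕ → ℤ)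
    (s : Finset (Orb (Fin a ×ₗ Fin b))) :
    (hubbardOpenBoxTT'W a b (fun x y => (W (siteRank x) (siteRank y) : ℝ) / Q) (fun x => (V (siteRank x) : ℝ) / Q)
        (fun x => (M (siteRank x) : ℝ) / Q) *ᵥ codedVec f) s =
      (((weightedCluster a b W V M).app (code s) f : ℝ) : ℂ) / ((Q : ℝ) : ℂ) := by
  have h := hubbardOpenBoxTT'W_scale (a := a) (b := b) (Q : ℝ)⁻¹ (fun x y => (W (siteRank x) (siteRank y) : ℝ))
    (fun x => (V (siteRank x) : ℝ)) (fun x => (M (siteRank x) : ℝ))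
  simp only [← div_eq_inv_mul] at h
  rw [h, Matrix.smul_mulVec, Pi.smul_apply, smul_eq_mul]
  have h2 := hubbardOpenBoxTT'W_mulVec_code (a := a) (b := b) W V M f s
  push_cast at h2 ⊢
  rw [h2]
  ring

/-! ### §2 Bound, spin exchange, the oracle's semantics, certificate form -/

/-- Structural sums of bounded integers are bounded by the sum of the bounds. [folklore] -/
private theorem abs_sumNat_le_sumNat (f : ℕ → ℤ) (g : ℕ → ℕ) (hf : ∀ i, |f i| ≤ (g i : ℤ)) :
    ∀ n : ℕ, |sumNat f n| ≤ ((sumNat g n : ℕ) : ℤ)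
  | 0 => by simp [sumNat]
  | n + 1 => by
      rw [sumNat, sumNat, Nat.cast_add]
      exact (abs_add_le _ _).trans (add_le_add (abs_sumNat_le_sumNat f g hf n) (hf n))

/-- `|hopCode| ≤ 1`. [cite: LinGubernatis1993, §II] -/
private theorem abs_hopCode_le' (p q m n : ℕ) : |hopCode p q m n| ≤ 1 := by
  unfold hopCode
  split_ifs <;> simp

/-- `|openBoxHopW W adj N m m'| ≤ 2·ΣΣ|W|`. [cite: LinGubernatis1993, §II] -/
private theorem abs_openBoxHopW_le (W : ℕ → ℕ → ℤ) (adj : ℕ → ℕ → Bool) (N m m' : ℕ) :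
    |openBoxHopW W adj N m m'| ≤ 2 * ((sumNat (fun P => sumNat (fun Q => (W P Q).natAbs) N) N : ℕ) : ℤ) := by
  unfold openBoxHopW
  have key := abs_sumNat_le_sumNat (fun P => sumNat (fun Q => if adj P Q then
      W P Q * sumNat (fun σ => hopCode (2 * P + σ) (2 * Q + σ) m m') 2 else 0) N)
    (fun P => sumNat (fun Q => 2 * (W P Q).natAbs) N) (fun P => ?_) N
  · refine key.trans ?_
    have e : ∀ n, sumNat (fun P => sumNat (fun Q => 2 * (W P Q).natAbs) N) n =
        2 * sumNat (fun P => sumNat (fun Q => (W P Q).natAbs) N) n := by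
      intro n
      have e1 : ∀ P k, sumNat (fun Q => 2 * (W P Q).natAbs) k = 2 * sumNat (fun Q => (W P Q).natAbs) k := by
        intro P k; induction k with
        | zero => simp [sumNat]
        | succ k ih => rw [sumNat, sumNat, ih]; ring
      induction n with
      | zero => simp [sumNat]
      | succ n ih => rw [sumNat, sumNat, ih, e1]; ring
    rw [e N]; push_cast; exact le_rfl
  · refine abs_sumNat_le_sumNat _ _ (fun Q => ?_) N
    split_ifs
    · have h2 := abs_sumNat_le_sumNat (fun σ => hopCode (2 * P + σ) (2 * Q + σ) m m') (fun _ => 1)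
        (fun σ => by simpa using abs_hopCode_le' _ _ _ _) 2
      have h2' : |sumNat (fun σ => hopCode (2 * P + σ) (2 * Q + σ) m m') 2| ≤ 2 := by
        simpa [sumNat] using h2
      rw [abs_mul]
      calc |W P Q| * |sumNat (fun σ => hopCode (2 * P + σ) (2 * Q + σ) m m') 2|
          ≤ |W P Q| * 2 := mul_le_mul_of_nonneg_left h2' (abs_nonneg _)
        _ = ((2 * (W P Q).natAbs : ℕ) : ℤ) := by push_cast; ring
    · simp

/-- `|doccCodeW V N m m'| ≤ Σ|V|`. [cite: LinGubernatis1993, §II] -/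
private theorem abs_doccCodeW_le (V : ℕ → ℤ) (N m m' : ℕ) :
    |doccCodeW V N m m'| ≤ ((sumNat (fun P => (V P).natAbs) N : ℕ) : ℤ) := by
  unfold doccCodeW
  split_ifs
  · exact abs_sumNat_le_sumNat _ _ (fun P => by
      split_ifs
      · exact le_of_eq (Int.natCast_natAbs (V P)).symm
      · simp) N
  · simp

/-- `|densCodeW M N m m'| ≤ 2·Σ|M|`. [cite: LinGubernatis1993, §II] -/
private theorem abs_densCodeW_le (M : ℕ → ℤ) (N m m' : ℕ) :
    |densCodeW M N m m'| ≤ 2 * ((sumNat (fun P => (M P).natAbs) N : ℕ) : ℤ) := by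
  unfold densCodeW
  split_ifs
  · have key := abs_sumNat_le_sumNat (fun P => (if m.testBit (2 * P) then M P else 0) +
        (if m.testBit (2 * P + 1) then M P else 0)) (fun P => 2 * (M P).natAbs) (fun P => ?_) N
    · refine key.trans ?_
      have e : ∀ n, sumNat (fun P => 2 * (M P).natAbs) n = 2 * sumNat (fun P => (M P).natAbs) n := by
        intro n; induction n with
        | zero => simp [sumNat]
        | succ n ih => rw [sumNat, sumNat, ih]; ring
      rw [e N]; push_cast; exact le_rfl
    · refine (abs_add_le _ _).trans ?_
      push_cast
      split_ifs <;> (try simp only [abs_zero, add_zero, zero_add]) <;> linarith [abs_nonneg (M P)]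
  · simp

/-- **`|hzIntW a b W V M m m'| ≤ hzBoundW (ab) W V M`.** [cite: LinGubernatis1993, §II] -/
theorem abs_hzIntW_le (W : ℕ → ℕ → ℤ) (V M : ℕ → ℤ) (m m' : ℕ) :
    |hzIntW a b W V M m m'| ≤ (hzBoundW (a * b) W V M : ℤ) := by
  unfold hzIntW hzBoundW
  have h1 := abs_openBoxHopW_le W (boxAdjCode b) (a * b) m m'
  have h2 := abs_doccCodeW_le V (a * b) m m'
  have h3 := abs_densCodeW_le M (a * b) m m'
  rw [← abs_neg] at h1
  push_cast
  refine ((abs_add_le _ _).trans (add_le_add ((abs_add_le _ _).trans (add_le_add h1 h2)) h3)).trans ?_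
  exact le_of_eq (by ring)

/-- **The weighted cluster Hamiltonian is spin-exchange invariant**: `Γ h^W Γ⁻¹ = h^W` (the hopping weights do
not depend on the spin; `n↑n↓` and `n↑ + n↓` are symmetric). [cite: LiebPRL1989, proof of Theorem 1] -/
theorem relabel_spinSwap_hubbardOpenBoxTT'W (τ : Fin a ×ₗ Fin b → Fin a ×ₗ Fin b → ℝ) (υ ν : Fin a ×ₗ Fin b → ℝ) :
    relabel (Orb.spinSwap : Orb (Fin a ×ₗ Fin b) ≃ Orb (Fin a ×ₗ Fin b)) (hubbardOpenBoxTT'W a b τ υ ν) =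
      hubbardOpenBoxTT'W a b τ υ ν := by
  unfold hubbardOpenBoxTT'W
  rw [map_add, map_add, map_neg, map_sum, map_sum, map_sum]
  congr 1
  congr 1
  · congr 1
    refine Finset.sum_congr rfl fun x _ => ?_
    rw [map_sum]
    refine Finset.sum_congr rfl fun y _ => ?_
    rw [map_sum]
    refine Fintype.sum_equiv (Equiv.swap (0 : Fin 2) 1) _ _ fun σ => ?_
    split_ifs
    · rw [map_smul, map_mul, relabel_creation, relabel_annihilation, Orb.spinSwap_orb, Orb.spinSwap_orb]
    · rw [map_zero]
  · refine Finset.sum_congr rfl fun x _ => ?_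
    rw [map_smul, relabel_spinSwap_numberOp_mul_numberOp]
  · refine Finset.sum_congr rfl fun x _ => ?_
    rw [map_smul, map_add, relabel_spinSwap_numberOp, relabel_spinSwap_numberOp, Equiv.swap_apply_left,
      Equiv.swap_apply_right, add_comm]

/-- **SEMANTICS OF THE WEIGHTED ORACLE.** For a symmetric weight table `W` (any `Q`; the checker itself decides
`0 < Q`), `(weightedCluster a b W V M).Models a b (hzIntW a b W V M) Q (h^W_{a×b}(W/Q, V/Q, M/Q))`.
[cite: LinGubernatis1993, §II] [cite: ValentiStolzeHirschfeld1991, §II] -/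
theorem weightedCluster_models (W : ℕ → ℕ → ℤ) (hW : ∀ P Q, W P Q = W Q P) (V M : ℕ → ℤ) (Q : ℕ) :
    (weightedCluster a b W V M).Models a b (hzIntW a b W V M) Q
      (hubbardOpenBoxTT'W a b (fun x y => (W (siteRank x) (siteRank y) : ℝ) / Q) (fun x => (V (siteRank x) : ℝ) / Q)
        (fun x => (M (siteRank x) : ℝ) / Q)) where
  apply_eq s s' := by
    rw [hubbardOpenBoxTT'W_apply_eq_hzIntW_div, Complex.ofReal_div]
  mulVec_eq f s := hubbardOpenBoxTT'W_mulVec_code_div W V M Q f s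
  preserves := preservesSectors_hubbardOpenBoxTT'W _ _ _
  symm s s' := hzIntW_code_symm W hW V M s s'
  abs_le m m' := abs_hzIntW_le W V M m m'

/-- **The symmetrised weight table**: `symW W₀ P Q = W₀ P Q` for `P < Q`, `W₀ Q P` otherwise (a certificate ships
only the entries `P < Q`; symmetry then needs no check). [cite: ValentiStolzeHirschfeld1991, §II] -/
def symW (W₀ : ℕ → ℕ → ℤ) (P Q : ℕ) : ℤ := if P < Q then W₀ P Q else W₀ Q P

/-- `symW W₀` is symmetric. [cite: ValentiStolzeHirschfeld1991, §II] -/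
theorem symW_symm (W₀ : ℕ → ℕ → ℤ) (P Q : ℕ) : symW W₀ P Q = symW W₀ Q P := by
  unfold symW
  rcases lt_trichotomy P Q with h | h | h
  · rw [if_pos h, if_neg (Nat.lt_asymm h)]
  · subst h; rfl
  · rw [if_neg (Nat.lt_asymm h), if_pos h]

/-- **Certificate form for the weighted cluster (sectors `p ≤ q`, checks in pieces).** For the weighted open
`a × b` cluster with rational weight tables `(W/Q, V/Q, M/Q)` (`W` symmetric) and a particle number `k ≤ 2ab`:
if for every `p ≤ k` with `p ≤ k − p` a data-free certificate `certs p` with code list `Ls p` of the spin sector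
`(p, k − p)` PASSES the generic kernel checker for the oracle `weightedCluster a b W V M` and its floor is `≥ σ`,
then `σ ≤ E₀(h^W_{a×b}, k)` — the hypothesis `hF` of `ClusterLowerBound.energyDensityTT'_ge_of_boxFloorsW_2x3`.
[cite: KullEtAl2024, §5.3] [cite: ValentiStolzeHirschfeld1991, §II] -/
theorem groundEnergy_ge_of_kCertsW₃ (a b : ℕ) (W : ℕ → ℕ → ℤ) (hW : ∀ P Q, W P Q = W Q P) (V M : ℕ → ℤ) (Q : ℕ)
    {k : ℕ} (hk : k ≤ 2 * (a * b)) (σ : ℚ) (Ls : ℕ → List ℕ) (certs : ℕ → KCert)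
    (hpass : ∀ p ≤ k, p ≤ k - p → (certs p).PassesG (weightedCluster a b W V M) a b p (k - p) Q (Ls p))
    (hσ : ∀ p ≤ k, p ≤ k - p → σ ≤ (certs p).floor Q) :
    (σ : ℝ) ≤ groundEnergy (hubbardOpenBoxTT'W a b (fun x y => (W (siteRank x) (siteRank y) : ℝ) / Q)
      (fun x => (V (siteRank x) : ℝ) / Q) (fun x => (M (siteRank x) : ℝ) / Q)) k :=
  groundEnergy_ge_of_kCertsG₃ (weightedCluster_models W hW V M Q) (relabel_spinSwap_hubbardOpenBoxTT'W _ _ _)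
    hk σ Ls certs hpass hσ

end Box

end OccupationCode

end Literature.MathematicalPhysics.QuantumLattice
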